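import Summits.Ventures.Crystal3D.Theorems.StickyWulffConstantCoaxialWallLawTriadicRegistry
import Summits.Ventures.Crystal3D.Theorems.StickyWulffConstantCoaxialWallLawSkewArithmetic
import HarnessLib

/-!
# Co-axial pairs with a NON-TRIADIC offset are free at `c₀ = 1`: height form, half-layer offsets, and lane F's stub
# conclusion verbatim (crux `CoaxialWallLaw`, stmt-Ventures-19481, line `WallLedgerF`)

HONEST FRAMING. Venture `Summits/Ventures/Crystal3D` (cell `crystal3d-full`), helper `--supports` the crux
`CoaxialWallLaw` of `route-Ventures-StickyWulffConstant` (REGISTERED line `WallLedgerF`, open stub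
`stub_coaxialTwoSlabAdhesion`).  Rung credit only; F-C1 not moved; NOT the stub: `ExactOnly`(C12-55) [E1] and
`StarPairFar` [certified; kernel at computational grade] stay BY NAME, and the TRIADIC offsets (`A₁⁻¹(t₂ − t₁) ∈ Λ₀[1/3]`:
fault/Shockley cosets, two-partial cosets `⅓·slot`) remain the crux's census.

Corollaries of `genericWallFloorAt_of_not_triadic` (`…TriadicRegistry`) with the crux's co-axiality data `hco` in place of
the frame hypothesis (`triadicLattice_of_coaxial`: a co-axial partner is the same linear lattice or a mirror twin, both map
`Λ₀` into `A₁·Λ₀[1/3]`):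
* **`genericWallFloorAt_coaxial_of_not_triadic`** — `t₂ − t₁ ∉ A₁·Λ₀[1/3]` ⇒ `GenericWallFloorAt A₁ t₁ A₂ t₂` (`c₀ = 1`,
  arbitrary fillings, modulo E1/StarPairFar);
* **`genericWallFloorAt_coaxial_of_height`** — HEIGHT FORM: if the offset's component along ANY `{111}` menu normal `ν` of
  grain 1 (e.g. the common axis: the basal-plane offset `τ`) is `r·√(2/3)` with `3^j r ∉ ℤ` for every `j`, the pair is free;
  **`genericWallFloorAt_coaxial_of_height_half`** — `r = a + ½` (grain 2's basal planes half-way between grain 1's, the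
  class of lit's F⁻ minimiser `T*`): free;
* **`not_pow_three_smul_mem_of_classA`** / **`genericWallFloorAt_classA`** — 19481-p2's CLASS (A) offsets (all six
  `p_i ± p_j ∈ ℤ`, `p = √2·cubicCoords τ`, `τ ∉ Λ₀`: the octahedral/tetrahedral hole cosets, `…IncoherentOffset`) are NOT
  triadic, hence every class-(A) translation pair is free at `c₀ = 1` for ARBITRARY fillings (19481-p2 had rigid / thin /
  gas fillings input-free; here arbitrary fillings modulo E1/StarPairFar);
* **`coaxialTwoSlabAdhesion_of_not_triadic`** — lane F's currency: `stub_coaxialTwoSlabAdhesion`'s conclusion VERBATIM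
  for such pairs (defender's frame = the common frame `L`, charge `½·√(1 − ⟪L e₃, e₃⟫²) ≤ 1`), arbitrary fillings,
  modulo E1/StarPairFar.
READING.  Registered (= possibly not free) co-axial offsets are TRIADIC: cubic coordinates in `ℤ[1/3]` with even sum.
OUT (free at `c₀ = 1 ≥ ½ sin θ`): every octahedral/tetrahedral HOLE coset (class (A): height `(ℤ+½)·d₀` resp. `(ℤ±¼)·d₀`
along `(1,1,1)`), every half-layer offset, every offset with an irrational coordinate.  IN (open, the census): the
fault/Shockley-partial cosets and the two-partial cosets `⅓·slot`.
WHAT THIS IS NOT: not the stub; F-C1 not moved.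
-/

noncomputable section

namespace Summit.Ventures.Crystal3D.Theorems

open Summit.Ventures.Crystal3D Finset
open Literature.MathematicalPhysics.StatisticalMechanics (fccStacking barlowStacking IsHaggSeq contactDeficiency)
open scoped InnerProductSpace

/-! ### Co-axial pairs (lane F) -/

open scoped Classical in
/-- **Every CO-AXIAL pair with a non-triadic offset satisfies the wall floor at `c₀ = 1`** (arbitrary fillings, modulo
`ExactOnly`(C12-55) and `StarPairFar`).  Co-axiality is the crux's data. -/
theorem genericWallFloorAt_coaxial_of_not_triadic
    {s₀ : EuclideanSpace ℝ (Fin 3)} (hs₀ : s₀ ∈ fccSlots)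
    (hcert : ExactOnly 0 (fccSlots.filter fun w => 0 < ⟪w, s₀⟫_ℝ)) (hfar : StarPairFar)
    (A₁ : EuclideanSpace ℝ (Fin 3) ≃ₗᵢ[ℝ] EuclideanSpace ℝ (Fin 3)) (t₁ : EuclideanSpace ℝ (Fin 3))
    (A₂ : EuclideanSpace ℝ (Fin 3) ≃ₗᵢ[ℝ] EuclideanSpace ℝ (Fin 3)) (t₂ : EuclideanSpace ℝ (Fin 3))
    (hco : ∃ (L : EuclideanSpace ℝ (Fin 3) ≃ₗᵢ[ℝ] EuclideanSpace ℝ (Fin 3))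
        (s₁ s₂ : EuclideanSpace ℝ (Fin 3)) (σ σ' : ℤ → ℤ), IsHaggSeq σ ∧ IsHaggSeq σ' ∧
        (fun p => A₁ p + t₁) '' fccStacking 1 (Real.sqrt (2 / 3)) ⊆
          (fun p => L p + s₁) '' barlowStacking 1 (Real.sqrt (2 / 3)) σ ∧
        (fun p => A₂ p + t₂) '' fccStacking 1 (Real.sqrt (2 / 3)) ⊆
          (fun p => L p + s₂) '' barlowStacking 1 (Real.sqrt (2 / 3)) σ')
    (ht : ¬ ∃ j : ℕ, ((3 : ℝ) ^ j) • A₁.symm (t₂ - t₁) ∈ fccStacking 1 (Real.sqrt (2 / 3))) :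
    GenericWallFloorAt A₁ t₁ A₂ t₂ :=
  genericWallFloorAt_of_not_triadic hs₀ hcert hfar (triadicLattice_of_coaxial A₁ t₁ A₂ t₂ hco) ht

open scoped Classical in
/-- **HEIGHT FORM.**  A co-axial pair whose offset has component `r·√(2/3)` along some `{111}` menu normal `ν` of grain 1
with `3^j r ∉ ℤ` for all `j` (in particular: along the COMMON axis, i.e. a non-triadic basal-plane offset `τ = r`)
satisfies the wall floor at `c₀ = 1` (arbitrary fillings, modulo `ExactOnly`(C12-55) and `StarPairFar`). -/
theorem genericWallFloorAt_coaxial_of_height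
    {s₀ : EuclideanSpace ℝ (Fin 3)} (hs₀ : s₀ ∈ fccSlots)
    (hcert : ExactOnly 0 (fccSlots.filter fun w => 0 < ⟪w, s₀⟫_ℝ)) (hfar : StarPairFar)
    (A₁ : EuclideanSpace ℝ (Fin 3) ≃ₗᵢ[ℝ] EuclideanSpace ℝ (Fin 3)) (t₁ : EuclideanSpace ℝ (Fin 3))
    (A₂ : EuclideanSpace ℝ (Fin 3) ≃ₗᵢ[ℝ] EuclideanSpace ℝ (Fin 3)) (t₂ : EuclideanSpace ℝ (Fin 3))
    (hco : ∃ (L : EuclideanSpace ℝ (Fin 3) ≃ₗᵢ[ℝ] EuclideanSpace ℝ (Fin 3))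
        (s₁ s₂ : EuclideanSpace ℝ (Fin 3)) (σ σ' : ℤ → ℤ), IsHaggSeq σ ∧ IsHaggSeq σ' ∧
        (fun p => A₁ p + t₁) '' fccStacking 1 (Real.sqrt (2 / 3)) ⊆
          (fun p => L p + s₁) '' barlowStacking 1 (Real.sqrt (2 / 3)) σ ∧
        (fun p => A₂ p + t₂) '' fccStacking 1 (Real.sqrt (2 / 3)) ⊆
          (fun p => L p + s₂) '' barlowStacking 1 (Real.sqrt (2 / 3)) σ')
    {ν : EuclideanSpace ℝ (Fin 3)}
    (hν : ∀ w ∈ fccSlots, ⟪A₁ w, ν⟫_ℝ = 0 ∨ ⟪A₁ w, ν⟫_ℝ = Real.sqrt (2 / 3) ∨ ⟪A₁ w, ν⟫_ℝ = -Real.sqrt (2 / 3))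
    {r : ℝ} (hr : ⟪t₂ - t₁, ν⟫_ℝ = r * Real.sqrt (2 / 3)) (hnot : ∀ j : ℕ, ∀ a : ℤ, (3 : ℝ) ^ j * r ≠ a) :
    GenericWallFloorAt A₁ t₁ A₂ t₂ :=
  genericWallFloorAt_coaxial_of_not_triadic hs₀ hcert hfar A₁ t₁ A₂ t₂ hco (not_triadicVec_of_inner hν hr hnot)

open scoped Classical in
/-- **Half-layer offsets are free.**  A co-axial pair whose offset has component `(a + ½)·√(2/3)` along a `{111}` menu
normal of grain 1 (grain 2's basal planes half-way between grain 1's: the class of lit's `T*`) satisfies the wall floor at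
`c₀ = 1` (arbitrary fillings, modulo `ExactOnly`(C12-55) and `StarPairFar`). -/
theorem genericWallFloorAt_coaxial_of_height_half
    {s₀ : EuclideanSpace ℝ (Fin 3)} (hs₀ : s₀ ∈ fccSlots)
    (hcert : ExactOnly 0 (fccSlots.filter fun w => 0 < ⟪w, s₀⟫_ℝ)) (hfar : StarPairFar)
    (A₁ : EuclideanSpace ℝ (Fin 3) ≃ₗᵢ[ℝ] EuclideanSpace ℝ (Fin 3)) (t₁ : EuclideanSpace ℝ (Fin 3))
    (A₂ : EuclideanSpace ℝ (Fin 3) ≃ₗᵢ[ℝ] EuclideanSpace ℝ (Fin 3)) (t₂ : EuclideanSpace ℝ (Fin 3))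
    (hco : ∃ (L : EuclideanSpace ℝ (Fin 3) ≃ₗᵢ[ℝ] EuclideanSpace ℝ (Fin 3))
        (s₁ s₂ : EuclideanSpace ℝ (Fin 3)) (σ σ' : ℤ → ℤ), IsHaggSeq σ ∧ IsHaggSeq σ' ∧
        (fun p => A₁ p + t₁) '' fccStacking 1 (Real.sqrt (2 / 3)) ⊆
          (fun p => L p + s₁) '' barlowStacking 1 (Real.sqrt (2 / 3)) σ ∧
        (fun p => A₂ p + t₂) '' fccStacking 1 (Real.sqrt (2 / 3)) ⊆
          (fun p => L p + s₂) '' barlowStacking 1 (Real.sqrt (2 / 3)) σ')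
    {ν : EuclideanSpace ℝ (Fin 3)}
    (hν : ∀ w ∈ fccSlots, ⟪A₁ w, ν⟫_ℝ = 0 ∨ ⟪A₁ w, ν⟫_ℝ = Real.sqrt (2 / 3) ∨ ⟪A₁ w, ν⟫_ℝ = -Real.sqrt (2 / 3))
    (a : ℤ) (hhalf : ⟪t₂ - t₁, ν⟫_ℝ = (a + 1 / 2) * Real.sqrt (2 / 3)) :
    GenericWallFloorAt A₁ t₁ A₂ t₂ :=
  genericWallFloorAt_coaxial_of_not_triadic hs₀ hcert hfar A₁ t₁ A₂ t₂ hco (not_triadicVec_of_inner_half hν a hhalf)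


/-! ### Class (A) offsets (hole cosets) are not triadic -/

/-- **Class (A) offsets are not triadic.**  If all six `p_i ± p_j` (`p = √2·cubicCoords τ`) are integers and `τ ∉ Λ₀`
(19481-p2's incoherent class (A): octahedral / tetrahedral hole cosets), then `3^j τ ∉ Λ₀` for every `j`: `3^j p` even-sum
integral with `2p` integral forces `p` integral (no factor `2` in `3^j`) and then even-sum, i.e. `τ ∈ Λ₀`. -/
theorem not_pow_three_smul_mem_of_classA {τ : EuclideanSpace ℝ (Fin 3)}
    (hall : ∀ i j : Fin 3, i ≠ j →
      (∃ z : ℤ, Real.sqrt 2 * cubicCoords τ i + Real.sqrt 2 * cubicCoords τ j = z) ∧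
      (∃ z : ℤ, Real.sqrt 2 * cubicCoords τ i - Real.sqrt 2 * cubicCoords τ j = z))
    (hτ : τ ∉ fccStacking 1 (Real.sqrt (2 / 3))) :
    ¬ ∃ j : ℕ, ((3 : ℝ) ^ j) • τ ∈ fccStacking 1 (Real.sqrt (2 / 3)) := by
  rintro ⟨j, hj⟩
  obtain ⟨a, b, c, habc, ha, hb, hc⟩ := exists_even_cubic_of_mem_fcc hj
  have hsc : ∀ i, Real.sqrt 2 * cubicCoords (((3 : ℝ) ^ j) • τ) i = (3 : ℝ) ^ j * (Real.sqrt 2 * cubicCoords τ i) := by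
    intro i; rw [cubicCoords_smul]; simp only [Pi.smul_apply, smul_eq_mul]; ring
  -- `2 p_i ∈ ℤ`
  have htwo : ∀ i : Fin 3, ∃ w : ℤ, 2 * (Real.sqrt 2 * cubicCoords τ i) = w := by
    intro i
    obtain ⟨i', hii'⟩ : ∃ i' : Fin 3, i ≠ i' := ⟨i + 1, by fin_cases i <;> decide⟩
    obtain ⟨⟨z, hz⟩, ⟨z', hz'⟩⟩ := hall i i' hii'
    exact ⟨z + z', by push_cast; linarith⟩
  -- `3^j p_i ∈ ℤ` and `2 p_i ∈ ℤ` force `p_i ∈ ℤ`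
  have hint : ∀ i : Fin 3, ∀ z : ℤ, Real.sqrt 2 * cubicCoords (((3 : ℝ) ^ j) • τ) i = z →
      ∃ m : ℤ, Real.sqrt 2 * cubicCoords τ i = m ∧ z = 3 ^ j * m := by
    intro i z hz
    rw [hsc] at hz
    obtain ⟨w, hw⟩ := htwo i
    have h2 : 2 * z = 3 ^ j * w := by
      have : ((2 * z : ℤ) : ℝ) = ((3 ^ j * w : ℤ) : ℝ) := by push_cast; rw [← hz, ← hw]; ring
      exact_mod_cast this
    have hw_even : Even w := by
      rcases Int.even_mul.1 (⟨z, by rw [← h2]; ring⟩ : Even ((3 : ℤ) ^ j * w)) with h3 | h3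
      · exact absurd h3 (Int.not_even_iff_odd.2 (Odd.pow (by decide)))
      · exact h3
    obtain ⟨m, hm⟩ := hw_even
    have hpm : Real.sqrt 2 * cubicCoords τ i = m := by
      have : (w : ℝ) = 2 * m := by rw [hm]; push_cast; ring
      linarith
    refine ⟨m, hpm, ?_⟩
    have : (z : ℝ) = ((3 ^ j * m : ℤ) : ℝ) := by push_cast; rw [← hz, hpm]
    exact_mod_cast this
  obtain ⟨m₀, hm₀, ha'⟩ := hint 0 a ha
  obtain ⟨m₁, hm₁, hb'⟩ := hint 1 b hb
  obtain ⟨m₂, hm₂, hc'⟩ := hint 2 c hc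
  have hsum : Even (m₀ + m₁ + m₂) := by
    rw [ha', hb', hc', ← mul_add, ← mul_add] at habc
    rcases Int.even_mul.1 habc with h3 | h3
    · exact absurd h3 (Int.not_even_iff_odd.2 (Odd.pow (by decide)))
    · exact h3
  exact hτ (mem_fcc_of_even_cubic m₀ m₁ m₂ hsum hm₀ hm₁ hm₂)

open scoped Classical in
/-- **Class (A) translation pairs are free at `c₀ = 1`, arbitrary fillings** (modulo `ExactOnly`(C12-55) and
`StarPairFar`): same linear lattice, offset `τ = A₁⁻¹(t₂ − t₁)` in class (A) and not a lattice vector. -/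
theorem genericWallFloorAt_classA
    {s₀ : EuclideanSpace ℝ (Fin 3)} (hs₀ : s₀ ∈ fccSlots)
    (hcert : ExactOnly 0 (fccSlots.filter fun w => 0 < ⟪w, s₀⟫_ℝ)) (hfar : StarPairFar)
    (A₁ : EuclideanSpace ℝ (Fin 3) ≃ₗᵢ[ℝ] EuclideanSpace ℝ (Fin 3)) (t₁ : EuclideanSpace ℝ (Fin 3))
    (A₂ : EuclideanSpace ℝ (Fin 3) ≃ₗᵢ[ℝ] EuclideanSpace ℝ (Fin 3)) (t₂ : EuclideanSpace ℝ (Fin 3))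
    (htrans : A₁ '' fccStacking 1 (Real.sqrt (2 / 3)) = A₂ '' fccStacking 1 (Real.sqrt (2 / 3)))
    (hall : ∀ i j : Fin 3, i ≠ j →
      (∃ z : ℤ, Real.sqrt 2 * cubicCoords (A₁.symm (t₂ - t₁)) i +
          Real.sqrt 2 * cubicCoords (A₁.symm (t₂ - t₁)) j = z) ∧
      (∃ z : ℤ, Real.sqrt 2 * cubicCoords (A₁.symm (t₂ - t₁)) i -
          Real.sqrt 2 * cubicCoords (A₁.symm (t₂ - t₁)) j = z))
    (hτ : A₁.symm (t₂ - t₁) ∉ fccStacking 1 (Real.sqrt (2 / 3))) :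
    GenericWallFloorAt A₁ t₁ A₂ t₂ :=
  genericWallFloorAt_of_not_triadic hs₀ hcert hfar (triadicLattice_of_image_eq htrans.symm)
    (not_pow_three_smul_mem_of_classA hall hτ)

/-! ### Lane F's stub conclusion -/

open scoped Classical in
/-- **Lane F's stub conclusion VERBATIM for co-axial pairs with a non-triadic offset** (the defender's frame = the common
frame `L` of the data, charge `½·√(1 − ⟪L e₃, e₃⟫²) ≤ 1`), arbitrary fillings, modulo `ExactOnly`(C12-55) and
`StarPairFar`. -/
theorem coaxialTwoSlabAdhesion_of_not_triadic
    {s₀ : EuclideanSpace ℝ (Fin 3)} (hs₀ : s₀ ∈ fccSlots)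
    (hcert : ExactOnly 0 (fccSlots.filter fun w => 0 < ⟪w, s₀⟫_ℝ)) (hfar : StarPairFar)
    (A₁ : EuclideanSpace ℝ (Fin 3) ≃ₗᵢ[ℝ] EuclideanSpace ℝ (Fin 3)) (t₁ : EuclideanSpace ℝ (Fin 3))
    (A₂ : EuclideanSpace ℝ (Fin 3) ≃ₗᵢ[ℝ] EuclideanSpace ℝ (Fin 3)) (t₂ : EuclideanSpace ℝ (Fin 3))
    (hco : ∃ (L : EuclideanSpace ℝ (Fin 3) ≃ₗᵢ[ℝ] EuclideanSpace ℝ (Fin 3))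
        (s₁ s₂ : EuclideanSpace ℝ (Fin 3)) (σ σ' : ℤ → ℤ), IsHaggSeq σ ∧ IsHaggSeq σ' ∧
        (fun p => A₁ p + t₁) '' fccStacking 1 (Real.sqrt (2 / 3)) ⊆
          (fun p => L p + s₁) '' barlowStacking 1 (Real.sqrt (2 / 3)) σ ∧
        (fun p => A₂ p + t₂) '' fccStacking 1 (Real.sqrt (2 / 3)) ⊆
          (fun p => L p + s₂) '' barlowStacking 1 (Real.sqrt (2 / 3)) σ')
    (ht : ¬ ∃ j : ℕ, ((3 : ℝ) ^ j) • A₁.symm (t₂ - t₁) ∈ fccStacking 1 (Real.sqrt (2 / 3))) :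
    ∃ (L : EuclideanSpace ℝ (Fin 3) ≃ₗᵢ[ℝ] EuclideanSpace ℝ (Fin 3))
        (s₁ s₂ : EuclideanSpace ℝ (Fin 3)) (σ σ' : ℤ → ℤ), IsHaggSeq σ ∧ IsHaggSeq σ' ∧
        (fun p => A₁ p + t₁) '' fccStacking 1 (Real.sqrt (2 / 3)) ⊆
          (fun p => L p + s₁) '' barlowStacking 1 (Real.sqrt (2 / 3)) σ ∧
        (fun p => A₂ p + t₂) '' fccStacking 1 (Real.sqrt (2 / 3)) ⊆
          (fun p => L p + s₂) '' barlowStacking 1 (Real.sqrt (2 / 3)) σ' ∧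
    ∃ C R₀ : ℝ, 1 ≤ R₀ ∧ ∀ h : ℝ, 0 ≤ h → ∀ ρ : ℝ, R₀ ≤ ρ →
      ∀ X P₁ P₂ : Finset (EuclideanSpace ℝ (Fin 3)),
      (∀ p ∈ X, ∀ q ∈ X, p ≠ q → 1 ≤ dist p q) → P₁ ⊆ X → P₂ ⊆ X \ P₁ →
      (∀ p ∈ X, -(2 * R₀) ≤ p 2 ∧ p 2 ≤ h + 2 * R₀ ∧ p 0 ^ 2 + p 1 ^ 2 ≤ ρ ^ 2) →
      (∀ p, p ∈ P₁ ↔ (p ∈ (fun q => A₁ q + t₁) '' fccStacking 1 (Real.sqrt (2 / 3)) ∧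
        -(2 * R₀) ≤ p 2 ∧ p 2 ≤ -R₀ ∧ p 0 ^ 2 + p 1 ^ 2 ≤ ρ ^ 2)) →
      (∀ p, p ∈ P₂ ↔ (p ∈ (fun q => A₂ q + t₂) '' fccStacking 1 (Real.sqrt (2 / 3)) ∧
        h + R₀ ≤ p 2 ∧ p 2 ≤ h + 2 * R₀ ∧ p 0 ^ 2 + p 1 ^ 2 ≤ ρ ^ 2)) →
      ((((P₁ ×ˢ (X \ P₁)).filter fun pq => dist pq.1 pq.2 = 1).card : ℕ) : ℝ) +
        ((((P₂ ×ˢ ((X \ P₁) \ P₂)).filter fun pq => dist pq.1 pq.2 = 1).card : ℕ) : ℝ) ≤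
        contactDeficiency ((X \ P₁) \ P₂) +
          (Real.sqrt 2 / 4 * ∑ᶠ w ∈ {w ∈ fccStacking 1 (Real.sqrt (2 / 3)) | ‖w‖ = 1},
              |⟪w, A₁.symm (EuclideanSpace.single (2 : Fin 3) (1 : ℝ))⟫_ℝ| +
            Real.sqrt 2 / 4 * ∑ᶠ w ∈ {w ∈ fccStacking 1 (Real.sqrt (2 / 3)) | ‖w‖ = 1},
              |⟪w, A₂.symm (EuclideanSpace.single (2 : Fin 3) (1 : ℝ))⟫_ℝ| -
            (1 / 2 : ℝ) * Real.sqrt (1 - ⟪L (EuclideanSpace.single (2 : Fin 3) (1 : ℝ)),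
              (EuclideanSpace.single (2 : Fin 3) (1 : ℝ))⟫_ℝ ^ 2)) * Real.pi * ρ ^ 2 +
          C * (1 + h) * ρ := by
  have hone := twoSlabLedgerAt_one_of_not_triadic hs₀ hcert hfar (triadicLattice_of_coaxial A₁ t₁ A₂ t₂ hco) ht
  obtain ⟨L, s₁, s₂, σ, σ', hσ, hσ', hsub₁, hsub₂⟩ := hco
  have hle : (1 / 2 : ℝ) * Real.sqrt (1 - ⟪L (EuclideanSpace.single (2 : Fin 3) (1 : ℝ)),
      (EuclideanSpace.single (2 : Fin 3) (1 : ℝ))⟫_ℝ ^ 2) ≤ 1 := by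
    have h1 : Real.sqrt (1 - ⟪L (EuclideanSpace.single (2 : Fin 3) (1 : ℝ)),
        (EuclideanSpace.single (2 : Fin 3) (1 : ℝ))⟫_ℝ ^ 2) ≤ 1 := by
      rw [show (1 : ℝ) = Real.sqrt 1 from Real.sqrt_one.symm]
      exact Real.sqrt_le_sqrt (by rw [Real.sqrt_one]; nlinarith [sq_nonneg ⟪L (EuclideanSpace.single (2 : Fin 3) (1 : ℝ)),
        (EuclideanSpace.single (2 : Fin 3) (1 : ℝ))⟫_ℝ])
    linarith
  exact ⟨L, s₁, s₂, σ, σ', hσ, hσ', hsub₁, hsub₂, twoSlabLedgerAt_mono hle hone⟩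

end Summit.Ventures.Crystal3D.Theorems

end
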